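import Summits.HodgeConjecture.HodgeConjecture.Theorems.K2E1EisensteinCompactRangeMajorantCMThree   -- ★ p859036 (this seat): §1 positive series at `N = 3` (`…_one_ofReal_three`, `norm_…_const_ofReal_three`, …); brings ★ :82, ★ R1₃, ★ Godement∕continuity CM-three
import Summits.HodgeConjecture.HodgeConjecture.Theorems.K2E1SiegelSmearSetU3                      -- ★ (this seat) (R-b)₃ geometric half: `exists_siegel_smear_cm_three`
import Summits.HodgeConjecture.HodgeConjecture.Theorems.K2E1ResidueUniformMajorantCMTwo             -- ★ p858880 (K2E4-p14 g7) (R-b) at `N = 2`: the generic scalar lemmas `rpow_le_one_add_rpow`, `rpow_le_const_mul_rpow`; brings ★ `exists_smear_borelHeight`, ★ `borelHeight_toAdelic_mul_le_max_three`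
import HarnessLib

/-!
# K2·E1 — `K2E1ResidueUniformMajorantCMThree` (road (ρ2)₃ «G7 PROPER», file (R-b)₃): THE `(σ, g)`-UNIFORM MAJORANT
# `(σ − 2)·‖E(φ₀H^σ)(g)‖ ≤ C·w₁(g)^A` FOR `σ ∈ (2, 2 + η]` OF THE SPHERICAL EISENSTEIN SERIES OF `U(2,1)_{L∕L⁺}` — HYPOTHESIS-FIRST ON ONE POLE LETTER

Track B ∕ K2-LIT, crux h413 = `stmt-HodgeConjecture-24833`, route of record `HCCMUnconditional`; cell `hodgecm-mathlib`, squad K2, ENGINE E1; campaign «EIS-R7-BL-SPH-3».  Prover seat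
`hodgecm-mathlib-K2-defs1` (g6); dealer K2E1-plan (g5) DEAL 2026-09-04T09:37:17Z («(R-b)₃ = N = 3 twin of ★ p858880 … it is (R-c)₃∕(ρ1)₃'s input on the 12R3 `ResidualCompactU3R` road»)
and LAST RULING (1) 09:42:12Z («🔴 the real-segment pole input is not ★ at N = 3 … (R-b)₃ := HYPOTHESIS-FIRST on ONE pole letter»).  THEOREMS ONLY (no `def`, no `instance`, no
notation, no `sorry`); lane `--supports stmt-HodgeConjecture-24833 --as helper` (count-neutral).  Closes no socket.

THE LETTER.  At `N = 2` the factor `(σ − 1)` absorbs the pole through ★ W5-B (`(z − 1)·c(z) → r`).  At `N = 3` the constant-term continuation is not yet assembled in the tree (★ LAYER 1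
`sphericalEisenstein_continuation_cm_three_of_layers` carries it as the letters `c r hcres hceq`; the Maass–Selberg pole control ★ needs `Im z ≠ 0`), so this file is HYPOTHESIS-FIRST on
the single letter
  **`hpole : ∀ K compact ⊆ G(𝔸), ∃ η > 0, ∃ M, ∀ σ ∈ (2, 2 + η], ∀ x ∈ K, (σ − 2)·‖E(H^σ)(x)‖ ≤ M`**
— local uniform boundedness of `(σ − 2)·E(1·H^σ)` at the pole `σ = 2ρ_H = 2` along the real segment (the natural output of the `N = 3` closer ∘ MS-3).  It is used ONLY on the compact
fibre `K = 𝓕̄ · 1`: averaging over the fundamental domain `𝓕` of `N(L⁺)∖N(𝔸)` and the constant term at the identity ★ `borelConstantTerm_sphericalEisenstein_cm_three_one`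
(`E(H^σ)_B(1) = 1 + c_ν(σ)`, `H(1) = 1`) turn it into **`(σ − 2)·‖c_ν(σ)‖ ≤ M + η`** (§3), `c_ν(σ) = (ν𝓕)⁻¹·∫_{N(𝔸)} H(ι(w₀)v)^σ dν` the scalar of ★ :82.  From there the road of ★ (R-b)
runs verbatim at `N = 3` on the ★ geometric half `K2E1SiegelSmearSetU3`: `γ g = u · y₀ · c′` (`u ∈ 𝓕̄`, `c′ ∈ C` compact, `H(y₀) = r^{[L:ℚ]}`, `r ≥ t`) and ★ smear `exists_smear_borelHeight`
give `Σ_q H(γ̃_q γg)^σ ≤ A₀^σ·Σ_q H(γ̃_q u y₀)^σ` for EVERY `u ∈ 𝓕`, hence (average, §2) `≤ A₀^σ·E(H^σ)_B(y₀) = A₀^σ·(H(y₀)^σ + c_ν(σ)·H(y₀)^{2−σ})` (★ :82); with `t^{[L:ℚ]} ≤ H(y₀) ≤ A₀·w₁(g)`,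
`w₁ ≥ c₁ > 0` ★ and the bookkeeping of §1 (`2 − σ` in place of `1 − σ`) the bound `C·w₁(g)^A` follows for every exponent `A > 2`.

* §1 scalar lemmas: `rpow_two_sub_le`, `residue_majorant_arith_three`.
* §2 the positive series at `N = 3`: `tsum_borelHeight_rpow_le_of_smear_three`, **`tsum_borelHeight_rpow_le_of_borelConstantTerm_three`** (the 𝓕-average).
* §3 **`sub_two_mul_norm_le_of_pole`** — the pole letter on `𝓕̄` bounds `(σ − 2)·‖c_ν(σ)‖`.
* §4 HEAD **`residue_uniform_majorant_cm_three_of_pole (hpole) (φ₀) (hA : 2 < A)`**: `∃ η > 0, ∃ C ≥ 0, ∀ σ ∈ (2, 2+η], ∀ g, (σ−2)·‖E(φ₀H^σ)(g)‖ ≤ C·(⨆_γ H(γ g))^A`; corollaries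
  `…_le_max` (`≤ C·max(H g, (H g)⁻¹)^A`, ★ `borelHeight_toAdelic_mul_le_max_three`) and `…_siegel` (`≤ C·H(g)^A` on `{1 ≤ H}`).
HONEST LABEL: HC_CM is proved only modulo the 7 printed citations (2 remaining named inputs: hLiu418 = `stmt-HodgeConjecture-24832`, h413 = `stmt-HodgeConjecture-24833`) until rung 0
closes; this file asserts no named fact and closes no socket; it is CONDITIONAL by construction on the displayed letter `hpole` (payer: the `N = 3` closer ∘ MS-3, not this week's line).
References: [MoeglinWaldspurger1995] I.2.2, II.1.5, II.1.7, IV.1.9 · [Garrett2018] §2.2–§2.3, §2.8, §3.10 · [Godement1964] §8 · [GetzHahn2024] Thm. 2.7.2 · [Rogawski1990] §2.2.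
-/

set_option autoImplicit false
-- the mandated namespace repeats the single-problem summit's segment (`HodgeConjecture.HodgeConjecture`)
set_option linter.dupNamespace false

noncomputable section

open MeasureTheory Measure NumberField IsDedekindDomain Set Filter Module MulAction
open scoped ENNReal NNReal Topology Classical Pointwise
open Literature.NumberTheory.Automorphic Literature.NumberTheory.Automorphic.UnitaryGroup AdelicGroupData
open Summit.HodgeConjecture.HodgeConjecture.Cruxes.H413.K2E1BorelEisensteinU
open Summit.HodgeConjecture.HodgeConjecture.Cruxes.H413.K2E1SphericalEisensteinContinuationU3Final (borelConstantTerm_sphericalEisenstein_cm_three borelConstantTerm_sphericalEisenstein_cm_three_one)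
open Summit.HodgeConjecture.HodgeConjecture.Cruxes.H413.K2E1BorelEisensteinGodementCMThree (summable_borelHeight_rpow_cm_three)
open Summit.HodgeConjecture.HodgeConjecture.Cruxes.H413.K2E1BorelEisensteinRegularCMThree (continuous_eisensteinSeriesU_flatSectionU_cm_three)
open Summit.HodgeConjecture.HodgeConjecture.Cruxes.H413.K2E1BorelEisensteinGodementU (exists_smear_borelHeight borelHeight_toAdelic_mul_le_max_three)
open Summit.HodgeConjecture.HodgeConjecture.Cruxes.H413.K2E1BLHeightCosetsU3 (borelHeight_mul_le_ciSup)
open Summit.HodgeConjecture.HodgeConjecture.Cruxes.H413.K2E1BLReductionCoveringU3 (exists_pos_forall_lt_ciSup_borelHeight_mul_cm_three)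
open Summit.HodgeConjecture.HodgeConjecture.Cruxes.H413.K2E1ResidueUniformMajorantCMTwo (rpow_le_one_add_rpow rpow_le_const_mul_rpow)
open Summit.HodgeConjecture.HodgeConjecture.Cruxes.H413.K2E1EisensteinCompactRangeMajorantCMThree (eisensteinSeriesU_flatSectionU_one_ofReal_three norm_eisensteinSeriesU_flatSectionU_const_ofReal_three tsum_borelHeight_rpow_nonneg_three)
open Summit.HodgeConjecture.HodgeConjecture.Cruxes.H413.K2E1SiegelSmearSetU3 (exists_siegel_smear_cm_three)
open Summit.HodgeConjecture.HodgeConjecture.Cruxes.H413.K2E1HeightFunctionU3 (borelHeight_one)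

namespace Summit.HodgeConjecture.HodgeConjecture.Cruxes.H413.K2E1ResidueUniformMajorantCMThree

/-! ## §1 Scalar lemmas (pole at `σ = 2`) -/

/-- `X^{2−σ} ≤ 1 + h₀^{−η}` for `0 < h₀ ≤ X`, `2 ≤ σ ≤ 2 + η`. [cite: MoeglinWaldspurger1995, II.1.5] -/
theorem rpow_two_sub_le {X h₀ σ η : ℝ} (hh₀ : 0 < h₀) (hX : h₀ ≤ X) (hσ : 2 ≤ σ) (hση : σ ≤ 2 + η) :
    X ^ (2 - σ) ≤ 1 + h₀⁻¹ ^ η := by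
  have hX0 : 0 < X := hh₀.trans_le hX
  rw [show (2 - σ) = -(σ - 2) by ring, Real.rpow_neg hX0.le, ← Real.inv_rpow hX0.le]
  calc X⁻¹ ^ (σ - 2) ≤ 1 + X⁻¹ ^ η := rpow_le_one_add_rpow (inv_nonneg.2 hX0.le) (sub_nonneg.2 hσ) (by linarith)
    _ ≤ 1 + h₀⁻¹ ^ η := add_le_add le_rfl (Real.rpow_le_rpow (inv_nonneg.2 hX0.le) (inv_anti₀ hh₀ hX) (by linarith))

/-- **The bookkeeping inequality at the pole `σ = 2`.**  If `2 < σ ≤ 2 + η ≤ a`, `1 ≤ A`, `0 < h₀ ≤ H ≤ A·w`, `0 < c₁ ≤ w`, `(σ−2)·n ≤ M` (`n ≥ 0`) and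
`S ≤ A^σ·(H^σ + n·H^{2−σ})`, then `(σ − 2)·S ≤ K·w^a` with `K = A^a·(η·(1 + (A c₁)^{−a})·A^a + M·(1 + h₀^{−η})·c₁^{−a})`. [cite: MoeglinWaldspurger1995, II.1.5] -/
theorem residue_majorant_arith_three {σ η a A M h₀ c₁ H w n S : ℝ} (hσ : 2 < σ) (hση : σ ≤ 2 + η) (hηa : 2 + η ≤ a) (hA : 1 ≤ A)
    (hh₀ : 0 < h₀) (hHt : h₀ ≤ H) (hHw : H ≤ A * w) (hc₁ : 0 < c₁) (hw : c₁ ≤ w) (hn : 0 ≤ n) (hM : (σ - 2) * n ≤ M)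
    (hS : S ≤ A ^ σ * (H ^ σ + n * H ^ (2 - σ))) :
    (σ - 2) * S ≤ A ^ a * (η * (1 + (A * c₁)⁻¹ ^ a) * A ^ a + M * (1 + h₀⁻¹ ^ η) * c₁⁻¹ ^ a) * w ^ a := by
  have hw0 : 0 < w := hc₁.trans_le hw
  have hH0 : 0 < H := hh₀.trans_le hHt
  have hη0 : 0 ≤ η := by linarith
  have ha0 : 0 ≤ a := by linarith
  have hσa : σ ≤ a := hση.trans hηa
  have hA0 : 0 < A := zero_lt_one.trans_le hA
  have hAσ : A ^ σ ≤ A ^ a := Real.rpow_le_rpow_of_exponent_le hA hσa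
  have hx₀ : 0 < A * c₁ := mul_pos hA0 hc₁
  have h1 : H ^ σ ≤ (1 + (A * c₁)⁻¹ ^ a) * (A ^ a * w ^ a) := by
    rw [← Real.mul_rpow hA0.le hw0.le]
    calc H ^ σ ≤ (A * w) ^ σ := Real.rpow_le_rpow hH0.le hHw (by linarith)
      _ ≤ _ := rpow_le_const_mul_rpow hx₀ (mul_le_mul_of_nonneg_left hw hA0.le) (by linarith) hσa
  have h2 : H ^ (2 - σ) ≤ 1 + h₀⁻¹ ^ η := rpow_two_sub_le hh₀ hHt hσ.le hση
  have h3 : (1 : ℝ) ≤ c₁⁻¹ ^ a * w ^ a := by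
    rw [← Real.mul_rpow (inv_nonneg.2 hc₁.le) hw0.le]
    exact Real.one_le_rpow ((one_le_inv_mul₀ hc₁).2 hw) ha0
  have hM0 : 0 ≤ M := le_trans (mul_nonneg (by linarith) hn) hM
  have hK2 : 0 ≤ 1 + h₀⁻¹ ^ η := by positivity
  have hsum : (σ - 2) * H ^ σ + (σ - 2) * n * H ^ (2 - σ) ≤ η * ((1 + (A * c₁)⁻¹ ^ a) * (A ^ a * w ^ a)) + M * (1 + h₀⁻¹ ^ η) :=
    add_le_add (mul_le_mul (by linarith) h1 (Real.rpow_nonneg hH0.le _) hη0) (mul_le_mul hM h2 (Real.rpow_nonneg hH0.le _) hM0)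
  have hsum0 : 0 ≤ (σ - 2) * H ^ σ + (σ - 2) * n * H ^ (2 - σ) :=
    add_nonneg (mul_nonneg (by linarith) (Real.rpow_nonneg hH0.le _)) (mul_nonneg (mul_nonneg (by linarith) hn) (Real.rpow_nonneg hH0.le _))
  calc (σ - 2) * S ≤ (σ - 2) * (A ^ σ * (H ^ σ + n * H ^ (2 - σ))) := mul_le_mul_of_nonneg_left hS (by linarith)
    _ = A ^ σ * ((σ - 2) * H ^ σ + (σ - 2) * n * H ^ (2 - σ)) := by ring
    _ ≤ A ^ a * (η * ((1 + (A * c₁)⁻¹ ^ a) * (A ^ a * w ^ a)) + M * (1 + h₀⁻¹ ^ η)) :=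
        mul_le_mul hAσ hsum hsum0 (Real.rpow_nonneg hA0.le _)
    _ ≤ A ^ a * (η * ((1 + (A * c₁)⁻¹ ^ a) * (A ^ a * w ^ a)) + M * (1 + h₀⁻¹ ^ η) * (c₁⁻¹ ^ a * w ^ a)) :=
        mul_le_mul_of_nonneg_left (add_le_add le_rfl (le_mul_of_one_le_right (mul_nonneg hM0 hK2) h3)) (Real.rpow_nonneg hA0.le _)
    _ = _ := by ring

variable (L : Type) [Field L] [NumberField L] [IsCMField L]

/-! ## §2 The positive series at `N = 3`: smear comparison and the average over `𝓕` -/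

/-- **SMEAR ⟹ COMPARISON OF THE POSITIVE SERIES** (`U(2,1)`): if `H(x g) ≤ A·H(x g′)` for all `x` then `Σ_q H(γ̃_q g)^σ ≤ A^σ·Σ_q H(γ̃_q g′)^σ` (`σ > 2`; both series converge by
★ Godement CM-three). [cite: Garrett2018, §3.10] [cite: MoeglinWaldspurger1995, II.1.5] -/
theorem tsum_borelHeight_rpow_le_of_smear_three {σ : ℝ} (hσ : 2 < σ) {A : ℝ≥0} {g g' : (quasiSplit (↥(maximalRealSubfield L)) L (IsCMField.complexConj L) 3).Adelic} (h : ∀ x : (quasiSplit (↥(maximalRealSubfield L)) L (IsCMField.complexConj L) 3).Adelic, borelHeight (x * g) ≤ A * borelHeight (x * g')) :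
    (∑' q : Quotient (MulAction.orbitRel ↥(borelU ((IsCMField.complexConj L : L ≃ₐ[↥(maximalRealSubfield L)] L) : L →+* L) ((StdForm.antidiagonal 3).over L)) ↥(unitaryGroupOfForm ((IsCMField.complexConj L : L ≃ₐ[↥(maximalRealSubfield L)] L) : L →+* L) ((StdForm.antidiagonal 3).over L))), ((borelHeight (((quasiSplit (↥(maximalRealSubfield L)) L (IsCMField.complexConj L) 3).toAdelic (Quotient.out q : ↥(unitaryGroupOfForm ((IsCMField.complexConj L : L ≃ₐ[↥(maximalRealSubfield L)] L) : L →+* L) ((StdForm.antidiagonal 3).over L)))) * (g)) : ℝ)) ^ σ) ≤ (A : ℝ) ^ σ * (∑' q : Quotient (MulAction.orbitRel ↥(borelU ((IsCMField.complexConj L : L ≃ₐ[↥(maximalRealSubfield L)] L) : L →+* L) ((StdForm.antidiagonal 3).over L)) ↥(unitaryGroupOfForm ((IsCMField.complexConj L : L ≃ₐ[↥(maximalRealSubfield L)] L) : L →+* L) ((StdForm.antidiagonal 3).over L))), ((borelHeight (((quasiSplit (↥(maximalRealSubfield L)) L (IsCMField.complexConj L) 3).toAdelic (Quotient.out q : ↥(unitaryGroupOfForm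 ((IsCMField.complexConj L : L ≃ₐ[↥(maximalRealSubfield L)] L) : L →+* L) ((StdForm.antidiagonal 3).over L)))) * (g')) : ℝ)) ^ σ) := by
  have hs := summable_borelHeight_rpow_cm_three L hσ g
  have hs' := summable_borelHeight_rpow_cm_three L hσ g'
  rw [← tsum_mul_left]
  refine hs.tsum_le_tsum (fun q => ?_) (hs'.mul_left _)
  rw [← Real.mul_rpow (NNReal.coe_nonneg A) (NNReal.coe_nonneg _)]
  exact Real.rpow_le_rpow (NNReal.coe_nonneg _) (by exact_mod_cast h _) (by linarith)

variable [MeasurableSpace (quasiSplit (↥(maximalRealSubfield L)) L (IsCMField.complexConj L) 3).Adelic] [BorelSpace (quasiSplit (↥(maximalRealSubfield L)) L (IsCMField.complexConj L) 3).Adelic]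

/-- **THE AVERAGE OVER `𝓕` AT `N = 3`: `Σ_q H(γ̃_q g)^σ ≤ A^σ·(H(t)^σ + ‖c_σ‖·H(t)^{2−σ})`** whenever `H(x g) ≤ A·H(x·u t)` for all `x` and all `u` in a fundamental domain `𝓕` of `N(L⁺)∖N(𝔸)` with
compact closure, and the constant term of `E(H^σ)` at `t` is `H(t)^σ + c_σ·H(t)^{2−σ}` (★ :82): the positive series at `g` is dominated termwise by the one at `u t` for EVERY `u ∈ 𝓕`, hence
by its `ν`-average, i.e. by `A^σ` times the constant term (integrability on `𝓕` from continuity ★ `continuous_eisensteinSeriesU_flatSectionU_cm_three`).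
[cite: MoeglinWaldspurger1995, II.1.5 and II.1.7] [cite: Garrett2018, §2.8] -/
theorem tsum_borelHeight_rpow_le_of_borelConstantTerm_three (ν : Measure ↥(adelicUnipotent (↥(maximalRealSubfield L)) L (IsCMField.complexConj L) 3)) [ν.IsHaarMeasure] {𝓕 : Set ↥(adelicUnipotent (↥(maximalRealSubfield L)) L (IsCMField.complexConj L) 3)}
    (h𝓕N : IsFundamentalDomain ↥(rationalUnipotent (↥(maximalRealSubfield L)) L (IsCMField.complexConj L) 3) 𝓕 ν) (h𝓕c : IsCompact (closure 𝓕))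
    {σ : ℝ} (hσ : 2 < σ) {cσ : ℂ} {t g : (quasiSplit (↥(maximalRealSubfield L)) L (IsCMField.complexConj L) 3).Adelic} {A : ℝ≥0}
    (hCT : borelConstantTerm ν 𝓕 (eisensteinSeriesU (flatSectionU (fun _ : (quasiSplit (↥(maximalRealSubfield L)) L (IsCMField.complexConj L) 3).Adelic => (1 : ℂ)) ((σ : ℝ) : ℂ))) t = 1 * ((((borelHeight t : ℝ)) : ℂ) ^ ((σ : ℝ) : ℂ) + cσ * (((borelHeight t : ℝ)) : ℂ) ^ (2 - ((σ : ℝ) : ℂ))))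
    (hsm : ∀ u ∈ 𝓕, ∀ x : (quasiSplit (↥(maximalRealSubfield L)) L (IsCMField.complexConj L) 3).Adelic, borelHeight (x * g) ≤ A * borelHeight (x * ((u : (quasiSplit (↥(maximalRealSubfield L)) L (IsCMField.complexConj L) 3).Adelic) * t))) :
    (∑' q : Quotient (MulAction.orbitRel ↥(borelU ((IsCMField.complexConj L : L ≃ₐ[↥(maximalRealSubfield L)] L) : L →+* L) ((StdForm.antidiagonal 3).over L)) ↥(unitaryGroupOfForm ((IsCMField.complexConj L : L ≃ₐ[↥(maximalRealSubfield L)] L) : L →+* L) ((StdForm.antidiagonal 3).over L))), ((borelHeight (((quasiSplit (↥(maximalRealSubfield L)) L (IsCMField.complexConj L) 3).toAdelic (Quotient.out q : ↥(unitaryGroupOfForm ((IsCMField.complexConj L : L ≃ₐ[↥(maximalRealSubfield L)] L) : L →+* L) ((StdForm.antidiagonal 3).over L)))) * (g)) : ℝ)) ^ σ) ≤ (A : ℝ) ^ σ * ((borelHeight t : ℝ) ^ σ + ‖cσ‖ * (borelHeight t : ℝ) ^ (2 - σ)) := by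
  haveI := t2Space_adeleRing_of_numberField L
  haveI := locallyCompactSpace_adeleRing' L
  haveI : T2Space (quasiSplit (↥(maximalRealSubfield L)) L (IsCMField.complexConj L) 3).Adelic := inferInstanceAs (T2Space (adelic (↥(maximalRealSubfield L)) L (IsCMField.complexConj L) 3 ((StdForm.antidiagonal 3).over L)))
  have h𝓕₀ : ν 𝓕 ≠ 0 := measure_ne_zero_of_isFundamentalDomain_rationalUnipotent ν h𝓕N
  have h𝓕top : ν 𝓕 ≠ ∞ := ((measure_mono subset_closure).trans_lt h𝓕c.measure_lt_top).ne
  have hν : 0 < (ν 𝓕).toReal := ENNReal.toReal_pos h𝓕₀ h𝓕top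
  have hHt : 0 < (borelHeight t : ℝ) := by exact_mod_cast borelHeight_pos t
  -- continuity of the positive series along the fibre `𝓕·t`, integrability on `𝓕`
  have hz : (2 : ℝ) < (((σ : ℝ) : ℂ)).re := by rwa [Complex.ofReal_re]
  have hcontE : Continuous fun y : (quasiSplit (↥(maximalRealSubfield L)) L (IsCMField.complexConj L) 3).Adelic => eisensteinSeriesU (flatSectionU (fun _ : (quasiSplit (↥(maximalRealSubfield L)) L (IsCMField.complexConj L) 3).Adelic => (1 : ℂ)) ((σ : ℝ) : ℂ)) (y) :=
    continuous_eisensteinSeriesU_flatSectionU_cm_three L hz continuous_const (M := 1) (fun _ => by rw [norm_one])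
  have hSE : ∀ y : (quasiSplit (↥(maximalRealSubfield L)) L (IsCMField.complexConj L) 3).Adelic, eisensteinSeriesU (flatSectionU (fun _ : (quasiSplit (↥(maximalRealSubfield L)) L (IsCMField.complexConj L) 3).Adelic => (1 : ℂ)) ((σ : ℝ) : ℂ)) (y) = (((∑' q : Quotient (MulAction.orbitRel ↥(borelU ((IsCMField.complexConj L : L ≃ₐ[↥(maximalRealSubfield L)] L) : L →+* L) ((StdForm.antidiagonal 3).over L)) ↥(unitaryGroupOfForm ((IsCMField.complexConj L : L ≃ₐ[↥(maximalRealSubfield L)] L) : L →+* L) ((StdForm.antidiagonal 3).over L))), ((borelHeight (((quasiSplit (↥(maximalRealSubfield L)) L (IsCMField.complexConj L) 3).toAdelic (Quotient.out q : ↥(unitaryGroupOfForm ((IsCMField.complexConj L : L ≃ₐ[↥(maximalRealSubfield L)] L) : L →+* L) ((StdForm.antidiagonal 3).over L)))) * (y)) : ℝ)) ^ σ) : ℝ) : ℂ) := fun y => eisensteinSeriesU_flatSectionU_one_ofReal_three L σ y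
  have hcontS : Continuous fun u : ↥(adelicUnipotent (↥(maximalRealSubfield L)) L (IsCMField.complexConj L) 3) => (∑' q : Quotient (MulAction.orbitRel ↥(borelU ((IsCMField.complexConj L : L ≃ₐ[↥(maximalRealSubfield L)] L) : L →+* L) ((StdForm.antidiagonal 3).over L)) ↥(unitaryGroupOfForm ((IsCMField.complexConj L : L ≃ₐ[↥(maximalRealSubfield L)] L) : L →+* L) ((StdForm.antidiagonal 3).over L))), ((borelHeight (((quasiSplit (↥(maximalRealSubfield L)) L (IsCMField.complexConj L) 3).toAdelic (Quotient.out q : ↥(unitaryGroupOfForm ((IsCMField.complexConj L : L ≃ₐ[↥(maximalRealSubfield L)] L) : L →+* L) ((StdForm.antidiagonal 3).over L)))) * ((u : (quasiSplit (↥(maximalRealSubfield L)) L (IsCMField.complexConj L) 3).Adelic) * t)) : ℝ)) ^ σ) := by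
    have hfun : (fun u : ↥(adelicUnipotent (↥(maximalRealSubfield L)) L (IsCMField.complexConj L) 3) => (∑' q : Quotient (MulAction.orbitRel ↥(borelU ((IsCMField.complexConj L : L ≃ₐ[↥(maximalRealSubfield L)] L) : L →+* L) ((StdForm.antidiagonal 3).over L)) ↥(unitaryGroupOfForm ((IsCMField.complexConj L : L ≃ₐ[↥(maximalRealSubfield L)] L) : L →+* L) ((StdForm.antidiagonal 3).over L))), ((borelHeight (((quasiSplit (↥(maximalRealSubfield L)) L (IsCMField.complexConj L) 3).toAdelic (Quotient.out q : ↥(unitaryGroupOfForm ((IsCMField.complexConj L : L ≃ₐ[↥(maximalRealSubfield L)] L) : L →+* L) ((StdForm.antidiagonal 3).over L)))) * ((u : (quasiSplit (↥(maximalRealSubfield L)) L (IsCMField.complexConj L) 3).Adelic) * t)) : ℝ)) ^ σ)) = fun u : ↥(adelicUnipotent (↥(maximalRealSubfield L)) L (IsCMField.complexConj L) 3) => (eisensteinSeriesU (flatSectionU (fun _ : (quasiSplit (↥(maximalRealSubfield L)) L (IsCMField.complexConj L) 3).Adelic => (1 : ℂ)) ((σ : ℝ) : ℂ)) ((u : (quasiSplit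 (↥(maximalRealSubfield L)) L (IsCMField.complexConj L) 3).Adelic) * t)).re := by
      funext u
      rw [hSE, Complex.ofReal_re]
    rw [hfun]
    exact Complex.continuous_re.comp (hcontE.comp (continuous_subtype_val.mul continuous_const))
  have hint : IntegrableOn (fun u : ↥(adelicUnipotent (↥(maximalRealSubfield L)) L (IsCMField.complexConj L) 3) => (∑' q : Quotient (MulAction.orbitRel ↥(borelU ((IsCMField.complexConj L : L ≃ₐ[↥(maximalRealSubfield L)] L) : L →+* L) ((StdForm.antidiagonal 3).over L)) ↥(unitaryGroupOfForm ((IsCMField.complexConj L : L ≃ₐ[↥(maximalRealSubfield L)] L) : L →+* L) ((StdForm.antidiagonal 3).over L))), ((borelHeight (((quasiSplit (↥(maximalRealSubfield L)) L (IsCMField.complexConj L) 3).toAdelic (Quotient.out q : ↥(unitaryGroupOfForm ((IsCMField.complexConj L : L ≃ₐ[↥(maximalRealSubfield L)] L) : L →+* L) ((StdForm.antidiagonal 3).over L)))) * ((u : (quasiSplit (↥(maximalRealSubfield L)) L (IsCMField.complexConj L) 3).Adelic) * t)) : ℝ)) ^ σ)) 𝓕 ν :=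
    (hcontS.continuousOn.integrableOn_compact h𝓕c).mono_set subset_closure
  -- integrate the termwise comparison `S(g) ≤ A^σ·S(u t)` over `u ∈ 𝓕`
  have hpt : ∀ u ∈ 𝓕, (∑' q : Quotient (MulAction.orbitRel ↥(borelU ((IsCMField.complexConj L : L ≃ₐ[↥(maximalRealSubfield L)] L) : L →+* L) ((StdForm.antidiagonal 3).over L)) ↥(unitaryGroupOfForm ((IsCMField.complexConj L : L ≃ₐ[↥(maximalRealSubfield L)] L) : L →+* L) ((StdForm.antidiagonal 3).over L))), ((borelHeight (((quasiSplit (↥(maximalRealSubfield L)) L (IsCMField.complexConj L) 3).toAdelic (Quotient.out q : ↥(unitaryGroupOfForm ((IsCMField.complexConj L : L ≃ₐ[↥(maximalRealSubfield L)] L) : L →+* L) ((StdForm.antidiagonal 3).over L)))) * (g)) : ℝ)) ^ σ) ≤ (A : ℝ) ^ σ * (∑' q : Quotient (MulAction.orbitRel ↥(borelU ((IsCMField.complexConj L : L ≃ₐ[↥(maximalRealSubfield L)] L) : L →+* L) ((StdForm.antidiagonal 3).over L)) ↥(unitaryGroupOfForm ((IsCMField.complexConj L : L ≃ₐ[↥(maximalRealSubfield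 L)] L) : L →+* L) ((StdForm.antidiagonal 3).over L))), ((borelHeight (((quasiSplit (↥(maximalRealSubfield L)) L (IsCMField.complexConj L) 3).toAdelic (Quotient.out q : ↥(unitaryGroupOfForm ((IsCMField.complexConj L : L ≃ₐ[↥(maximalRealSubfield L)] L) : L →+* L) ((StdForm.antidiagonal 3).over L)))) * ((u : (quasiSplit (↥(maximalRealSubfield L)) L (IsCMField.complexConj L) 3).Adelic) * t)) : ℝ)) ^ σ) := fun u hu => tsum_borelHeight_rpow_le_of_smear_three L hσ (hsm u hu)
  have hI : (∑' q : Quotient (MulAction.orbitRel ↥(borelU ((IsCMField.complexConj L : L ≃ₐ[↥(maximalRealSubfield L)] L) : L →+* L) ((StdForm.antidiagonal 3).over L)) ↥(unitaryGroupOfForm ((IsCMField.complexConj L : L ≃ₐ[↥(maximalRealSubfield L)] L) : L →+* L) ((StdForm.antidiagonal 3).over L))), ((borelHeight (((quasiSplit (↥(maximalRealSubfield L)) L (IsCMField.complexConj L) 3).toAdelic (Quotient.out q : ↥(unitaryGroupOfForm ((IsCMField.complexConj L : L ≃ₐ[↥(maximalRealSubfield L)] L) : L →+* L) ((StdForm.antidiagonal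 3).over L)))) * (g)) : ℝ)) ^ σ) * (ν 𝓕).toReal ≤ (A : ℝ) ^ σ * ∫ u in 𝓕, (∑' q : Quotient (MulAction.orbitRel ↥(borelU ((IsCMField.complexConj L : L ≃ₐ[↥(maximalRealSubfield L)] L) : L →+* L) ((StdForm.antidiagonal 3).over L)) ↥(unitaryGroupOfForm ((IsCMField.complexConj L : L ≃ₐ[↥(maximalRealSubfield L)] L) : L →+* L) ((StdForm.antidiagonal 3).over L))), ((borelHeight (((quasiSplit (↥(maximalRealSubfield L)) L (IsCMField.complexConj L) 3).toAdelic (Quotient.out q : ↥(unitaryGroupOfForm ((IsCMField.complexConj L : L ≃ₐ[↥(maximalRealSubfield L)] L) : L →+* L) ((StdForm.antidiagonal 3).over L)))) * ((u : (quasiSplit (↥(maximalRealSubfield L)) L (IsCMField.complexConj L) 3).Adelic) * t)) : ℝ)) ^ σ) ∂ν := by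
    have hconst : ∫ _ in 𝓕, (∑' q : Quotient (MulAction.orbitRel ↥(borelU ((IsCMField.complexConj L : L ≃ₐ[↥(maximalRealSubfield L)] L) : L →+* L) ((StdForm.antidiagonal 3).over L)) ↥(unitaryGroupOfForm ((IsCMField.complexConj L : L ≃ₐ[↥(maximalRealSubfield L)] L) : L →+* L) ((StdForm.antidiagonal 3).over L))), ((borelHeight (((quasiSplit (↥(maximalRealSubfield L)) L (IsCMField.complexConj L) 3).toAdelic (Quotient.out q : ↥(unitaryGroupOfForm ((IsCMField.complexConj L : L ≃ₐ[↥(maximalRealSubfield L)] L) : L →+* L) ((StdForm.antidiagonal 3).over L)))) * (g)) : ℝ)) ^ σ) ∂ν = (∑' q : Quotient (MulAction.orbitRel ↥(borelU ((IsCMField.complexConj L : L ≃ₐ[↥(maximalRealSubfield L)] L) : L →+* L) ((StdForm.antidiagonal 3).over L)) ↥(unitaryGroupOfForm ((IsCMField.complexConj L : L ≃ₐ[↥(maximalRealSubfield L)] L) : L →+* L) ((StdForm.antidiagonal 3).over L))), ((borelHeight (((quasiSplit (↥(maximalRealSubfield L)) L (IsCMField.complexConj L) 3).toAdelic (Quotient.out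 q : ↥(unitaryGroupOfForm ((IsCMField.complexConj L : L ≃ₐ[↥(maximalRealSubfield L)] L) : L →+* L) ((StdForm.antidiagonal 3).over L)))) * (g)) : ℝ)) ^ σ) * (ν 𝓕).toReal := by
      rw [setIntegral_const, measureReal_def, smul_eq_mul, mul_comm]
    rw [← hconst, ← integral_const_mul]
    exact integral_mono_ae (integrableOn_const h𝓕top) (hint.const_mul _) ((ae_restrict_iff'₀ h𝓕N.nullMeasurableSet).2 (Eventually.of_forall hpt))
  -- the `ν`-average over `𝓕` IS the constant term (an identity in `ℂ`)
  have hCT2 : borelConstantTerm ν 𝓕 (eisensteinSeriesU (flatSectionU (fun _ : (quasiSplit (↥(maximalRealSubfield L)) L (IsCMField.complexConj L) 3).Adelic => (1 : ℂ)) ((σ : ℝ) : ℂ))) t = (((borelHeight t : ℝ)) : ℂ) ^ ((σ : ℝ) : ℂ) + cσ * (((borelHeight t : ℝ)) : ℂ) ^ (2 - ((σ : ℝ) : ℂ)) := by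
    rw [hCT, one_mul]
  have hCT' : (((ν 𝓕).toReal⁻¹ : ℝ)) • (((∫ u in 𝓕, (∑' q : Quotient (MulAction.orbitRel ↥(borelU ((IsCMField.complexConj L : L ≃ₐ[↥(maximalRealSubfield L)] L) : L →+* L) ((StdForm.antidiagonal 3).over L)) ↥(unitaryGroupOfForm ((IsCMField.complexConj L : L ≃ₐ[↥(maximalRealSubfield L)] L) : L →+* L) ((StdForm.antidiagonal 3).over L))), ((borelHeight (((quasiSplit (↥(maximalRealSubfield L)) L (IsCMField.complexConj L) 3).toAdelic (Quotient.out q : ↥(unitaryGroupOfForm ((IsCMField.complexConj L : L ≃ₐ[↥(maximalRealSubfield L)] L) : L →+* L) ((StdForm.antidiagonal 3).over L)))) * ((u : (quasiSplit (↥(maximalRealSubfield L)) L (IsCMField.complexConj L) 3).Adelic) * t)) : ℝ)) ^ σ) ∂ν : ℝ)) : ℂ) =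
      (((borelHeight t : ℝ)) : ℂ) ^ ((σ : ℝ) : ℂ) + cσ * (((borelHeight t : ℝ)) : ℂ) ^ (2 - ((σ : ℝ) : ℂ)) := by
    rw [← hCT2, borelConstantTerm_def, ← integral_complex_ofReal]
    simp_rw [hSE]
  have hnorm : (ν 𝓕).toReal⁻¹ * ∫ u in 𝓕, (∑' q : Quotient (MulAction.orbitRel ↥(borelU ((IsCMField.complexConj L : L ≃ₐ[↥(maximalRealSubfield L)] L) : L →+* L) ((StdForm.antidiagonal 3).over L)) ↥(unitaryGroupOfForm ((IsCMField.complexConj L : L ≃ₐ[↥(maximalRealSubfield L)] L) : L →+* L) ((StdForm.antidiagonal 3).over L))), ((borelHeight (((quasiSplit (↥(maximalRealSubfield L)) L (IsCMField.complexConj L) 3).toAdelic (Quotient.out q : ↥(unitaryGroupOfForm ((IsCMField.complexConj L : L ≃ₐ[↥(maximalRealSubfield L)] L) : L →+* L) ((StdForm.antidiagonal 3).over L)))) * ((u : (quasiSplit (↥(maximalRealSubfield L)) L (IsCMField.complexConj L) 3).Adelic) * t)) : ℝ)) ^ σ) ∂ν ≤ (borelHeight t : ℝ) ^ σ + ‖cσ‖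 * (borelHeight t : ℝ) ^ (2 - σ) := by
    have hre : (((σ : ℝ) : ℂ)).re = σ := Complex.ofReal_re σ
    have hre' : (2 - ((σ : ℝ) : ℂ)).re = 2 - σ := by rw [Complex.sub_re, Complex.ofReal_re]; norm_num
    calc (ν 𝓕).toReal⁻¹ * ∫ u in 𝓕, (∑' q : Quotient (MulAction.orbitRel ↥(borelU ((IsCMField.complexConj L : L ≃ₐ[↥(maximalRealSubfield L)] L) : L →+* L) ((StdForm.antidiagonal 3).over L)) ↥(unitaryGroupOfForm ((IsCMField.complexConj L : L ≃ₐ[↥(maximalRealSubfield L)] L) : L →+* L) ((StdForm.antidiagonal 3).over L))), ((borelHeight (((quasiSplit (↥(maximalRealSubfield L)) L (IsCMField.complexConj L) 3).toAdelic (Quotient.out q : ↥(unitaryGroupOfForm ((IsCMField.complexConj L : L ≃ₐ[↥(maximalRealSubfield L)] L) : L →+* L) ((StdForm.antidiagonal 3).over L)))) * ((u : (quasiSplit (↥(maximalRealSubfield L)) L (IsCMField.complexConj L) 3).Adelic) * t)) : ℝ)) ^ σ) ∂ν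
        ≤ ‖(((ν 𝓕).toReal⁻¹ : ℝ)) • (((∫ u in 𝓕, (∑' q : Quotient (MulAction.orbitRel ↥(borelU ((IsCMField.complexConj L : L ≃ₐ[↥(maximalRealSubfield L)] L) : L →+* L) ((StdForm.antidiagonal 3).over L)) ↥(unitaryGroupOfForm ((IsCMField.complexConj L : L ≃ₐ[↥(maximalRealSubfield L)] L) : L →+* L) ((StdForm.antidiagonal 3).over L))), ((borelHeight (((quasiSplit (↥(maximalRealSubfield L)) L (IsCMField.complexConj L) 3).toAdelic (Quotient.out q : ↥(unitaryGroupOfForm ((IsCMField.complexConj L : L ≃ₐ[↥(maximalRealSubfield L)] L) : L →+* L) ((StdForm.antidiagonal 3).over L)))) * ((u : (quasiSplit (↥(maximalRealSubfield L)) L (IsCMField.complexConj L) 3).Adelic) * t)) : ℝ)) ^ σ) ∂ν : ℝ)) : ℂ)‖ := by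
          rw [_root_.norm_smul, Real.norm_of_nonneg (inv_nonneg.2 hν.le), Complex.norm_real]
          exact mul_le_mul_of_nonneg_left (Real.le_norm_self _) (inv_nonneg.2 hν.le)
      _ = ‖(((borelHeight t : ℝ)) : ℂ) ^ ((σ : ℝ) : ℂ) + cσ * (((borelHeight t : ℝ)) : ℂ) ^ (2 - ((σ : ℝ) : ℂ))‖ := by rw [hCT']
      _ ≤ ‖(((borelHeight t : ℝ)) : ℂ) ^ ((σ : ℝ) : ℂ)‖ + ‖cσ * (((borelHeight t : ℝ)) : ℂ) ^ (2 - ((σ : ℝ) : ℂ))‖ := norm_add_le _ _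
      _ = (borelHeight t : ℝ) ^ σ + ‖cσ‖ * (borelHeight t : ℝ) ^ (2 - σ) := by
          rw [norm_mul, Complex.norm_cpow_eq_rpow_re_of_pos hHt, Complex.norm_cpow_eq_rpow_re_of_pos hHt, hre, hre']
  -- divide by `ν(𝓕) > 0`
  calc (∑' q : Quotient (MulAction.orbitRel ↥(borelU ((IsCMField.complexConj L : L ≃ₐ[↥(maximalRealSubfield L)] L) : L →+* L) ((StdForm.antidiagonal 3).over L)) ↥(unitaryGroupOfForm ((IsCMField.complexConj L : L ≃ₐ[↥(maximalRealSubfield L)] L) : L →+* L) ((StdForm.antidiagonal 3).over L))), ((borelHeight (((quasiSplit (↥(maximalRealSubfield L)) L (IsCMField.complexConj L) 3).toAdelic (Quotient.out q : ↥(unitaryGroupOfForm ((IsCMField.complexConj L : L ≃ₐ[↥(maximalRealSubfield L)] L) : L →+* L) ((StdForm.antidiagonal 3).over L)))) * (g)) : ℝ)) ^ σ) = (∑' q : Quotient (MulAction.orbitRel ↥(borelU ((IsCMField.complexConj L : L ≃ₐ[↥(maximalRealSubfield L)] L) : L →+* L) ((StdForm.antidiagonal 3).over L)) ↥(unitaryGroupOfForm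 ((IsCMField.complexConj L : L ≃ₐ[↥(maximalRealSubfield L)] L) : L →+* L) ((StdForm.antidiagonal 3).over L))), ((borelHeight (((quasiSplit (↥(maximalRealSubfield L)) L (IsCMField.complexConj L) 3).toAdelic (Quotient.out q : ↥(unitaryGroupOfForm ((IsCMField.complexConj L : L ≃ₐ[↥(maximalRealSubfield L)] L) : L →+* L) ((StdForm.antidiagonal 3).over L)))) * (g)) : ℝ)) ^ σ) * (ν 𝓕).toReal * (ν 𝓕).toReal⁻¹ := (mul_inv_cancel_right₀ hν.ne' _).symm
    _ ≤ (A : ℝ) ^ σ * (∫ u in 𝓕, (∑' q : Quotient (MulAction.orbitRel ↥(borelU ((IsCMField.complexConj L : L ≃ₐ[↥(maximalRealSubfield L)] L) : L →+* L) ((StdForm.antidiagonal 3).over L)) ↥(unitaryGroupOfForm ((IsCMField.complexConj L : L ≃ₐ[↥(maximalRealSubfield L)] L) : L →+* L) ((StdForm.antidiagonal 3).over L))), ((borelHeight (((quasiSplit (↥(maximalRealSubfield L)) L (IsCMField.complexConj L) 3).toAdelic (Quotient.out q : ↥(unitaryGroupOfForm ((IsCMField.complexConj L : L ≃ₐ[↥(maximalRealSubfield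 L)] L) : L →+* L) ((StdForm.antidiagonal 3).over L)))) * ((u : (quasiSplit (↥(maximalRealSubfield L)) L (IsCMField.complexConj L) 3).Adelic) * t)) : ℝ)) ^ σ) ∂ν) * (ν 𝓕).toReal⁻¹ := mul_le_mul_of_nonneg_right hI (inv_nonneg.2 hν.le)
    _ = (A : ℝ) ^ σ * ((ν 𝓕).toReal⁻¹ * ∫ u in 𝓕, (∑' q : Quotient (MulAction.orbitRel ↥(borelU ((IsCMField.complexConj L : L ≃ₐ[↥(maximalRealSubfield L)] L) : L →+* L) ((StdForm.antidiagonal 3).over L)) ↥(unitaryGroupOfForm ((IsCMField.complexConj L : L ≃ₐ[↥(maximalRealSubfield L)] L) : L →+* L) ((StdForm.antidiagonal 3).over L))), ((borelHeight (((quasiSplit (↥(maximalRealSubfield L)) L (IsCMField.complexConj L) 3).toAdelic (Quotient.out q : ↥(unitaryGroupOfForm ((IsCMField.complexConj L : L ≃ₐ[↥(maximalRealSubfield L)] L) : L →+* L) ((StdForm.antidiagonal 3).over L)))) * ((u : (quasiSplit (↥(maximalRealSubfield L)) L (IsCMField.complexConj L) 3).Adelic) * t)) : ℝ)) ^ σ)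 ∂ν) := by ring
    _ ≤ (A : ℝ) ^ σ * ((borelHeight t : ℝ) ^ σ + ‖cσ‖ * (borelHeight t : ℝ) ^ (2 - σ)) := mul_le_mul_of_nonneg_left hnorm (Real.rpow_nonneg (NNReal.coe_nonneg A) σ)

/-! ## §3 The pole letter on the compact fibre `𝓕̄` bounds `(σ − 2)·‖c_ν(σ)‖` -/

/-- **THE POLE LETTER CONTROLS THE SCALAR OF THE CONSTANT TERM**: if `(σ − 2)·‖E(H^σ)(u)‖ ≤ M` for all `u ∈ 𝓕̄` and all `σ ∈ (2, 2 + η]`, then `(σ − 2)·‖c_ν(σ)‖ ≤ M + η` there,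
`c_ν(σ) = (ν𝓕)⁻¹·∫_{N(𝔸)} H(ι(w₀)v)^σ dν` — average the letter over `𝓕` (`‖E(H^σ)_B(1)‖ ≤ M ∕ (σ − 2)`) and read `c_ν` off the constant term at the identity ★
`borelConstantTerm_sphericalEisenstein_cm_three_one` (`E(H^σ)_B(1) = 1 + c_ν(σ)`). [cite: MoeglinWaldspurger1995, II.1.7, IV.1.9] [cite: Garrett2018, §2.8] -/
theorem sub_two_mul_norm_le_of_pole (ν : Measure ↥(adelicUnipotent (↥(maximalRealSubfield L)) L (IsCMField.complexConj L) 3)) [ν.IsHaarMeasure] {𝓕 : Set ↥(adelicUnipotent (↥(maximalRealSubfield L)) L (IsCMField.complexConj L) 3)}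
    (h𝓕N : IsFundamentalDomain ↥(rationalUnipotent (↥(maximalRealSubfield L)) L (IsCMField.complexConj L) 3) 𝓕 ν) (h𝓕c : IsCompact (closure 𝓕)) {η M : ℝ}
    (hM : ∀ σ : ℝ, 2 < σ → σ ≤ 2 + η → ∀ u ∈ closure 𝓕, (σ - 2) * ‖eisensteinSeriesU (flatSectionU (fun _ : (quasiSplit (↥(maximalRealSubfield L)) L (IsCMField.complexConj L) 3).Adelic => (1 : ℂ)) ((σ : ℝ) : ℂ)) ((u : (quasiSplit (↥(maximalRealSubfield L)) L (IsCMField.complexConj L) 3).Adelic))‖ ≤ M)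
    {σ : ℝ} (hσ : 2 < σ) (hση : σ ≤ 2 + η) :
    (σ - 2) * ‖(((((ν 𝓕).toReal⁻¹ : ℝ)) : ℂ) * (∫ v : ↥(adelicUnipotent (↥(maximalRealSubfield L)) L (IsCMField.complexConj L) 3), (((borelHeight (((quasiSplit (↥(maximalRealSubfield L)) L (IsCMField.complexConj L) 3).toAdelic (weylLongU ((IsCMField.complexConj L : L ≃ₐ[↥(maximalRealSubfield L)] L) : L →+* L) (rfl : (StdForm.antidiagonal 3).over L = (StdForm.antidiagonal 3).over L))) * (v : (quasiSplit (↥(maximalRealSubfield L)) L (IsCMField.complexConj L) 3).Adelic))) : ℝ) : ℂ) ^ ((σ : ℝ) : ℂ) ∂ν))‖ ≤ M + η := by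
  have hz : (2 : ℝ) < (((σ : ℝ) : ℂ)).re := by rwa [Complex.ofReal_re]
  have h𝓕₀ : ν 𝓕 ≠ 0 := measure_ne_zero_of_isFundamentalDomain_rationalUnipotent ν h𝓕N
  have h𝓕top : ν 𝓕 < ∞ := (measure_mono subset_closure).trans_lt h𝓕c.measure_lt_top
  have hν : 0 < (ν 𝓕).toReal := ENNReal.toReal_pos h𝓕₀ h𝓕top.ne
  have hσ2 : 0 < σ - 2 := sub_pos.2 hσ
  -- the letter on `𝓕`, divided by `σ − 2`
  have hbd : ∀ u ∈ 𝓕, ‖eisensteinSeriesU (flatSectionU (fun _ : (quasiSplit (↥(maximalRealSubfield L)) L (IsCMField.complexConj L) 3).Adelic => (1 : ℂ)) ((σ : ℝ) : ℂ)) ((u : (quasiSplit (↥(maximalRealSubfield L)) L (IsCMField.complexConj L) 3).Adelic) * 1)‖ ≤ M / (σ - 2) := fun u hu => by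
    rw [mul_one, le_div_iff₀ hσ2, mul_comm]
    exact hM σ hσ hση u (subset_closure hu)
  -- `‖E(H^σ)_B(1)‖ ≤ M ∕ (σ − 2)`
  have hEB : ‖borelConstantTerm ν 𝓕 (eisensteinSeriesU (flatSectionU (fun _ : (quasiSplit (↥(maximalRealSubfield L)) L (IsCMField.complexConj L) 3).Adelic => (1 : ℂ)) ((σ : ℝ) : ℂ))) 1‖ ≤ M / (σ - 2) := by
    rw [borelConstantTerm_def, _root_.norm_smul, Real.norm_of_nonneg (inv_nonneg.2 hν.le)]
    calc (ν 𝓕).toReal⁻¹ * ‖∫ u in 𝓕, eisensteinSeriesU (flatSectionU (fun _ : (quasiSplit (↥(maximalRealSubfield L)) L (IsCMField.complexConj L) 3).Adelic => (1 : ℂ)) ((σ : ℝ) : ℂ)) ((u : (quasiSplit (↥(maximalRealSubfield L)) L (IsCMField.complexConj L) 3).Adelic) * 1) ∂ν‖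
        ≤ (ν 𝓕).toReal⁻¹ * (M / (σ - 2) * ν.real 𝓕) := mul_le_mul_of_nonneg_left (norm_setIntegral_le_of_norm_le_const h𝓕top hbd) (inv_nonneg.2 hν.le)
      _ = M / (σ - 2) * ((ν 𝓕).toReal * (ν 𝓕).toReal⁻¹) := by rw [measureReal_def]; ring
      _ = M / (σ - 2) := by rw [mul_inv_cancel₀ hν.ne', mul_one]
  -- `c_ν(σ) = E(H^σ)_B(1) − 1`
  have hc : (((((ν 𝓕).toReal⁻¹ : ℝ)) : ℂ) * (∫ v : ↥(adelicUnipotent (↥(maximalRealSubfield L)) L (IsCMField.complexConj L) 3), (((borelHeight (((quasiSplit (↥(maximalRealSubfield L)) L (IsCMField.complexConj L) 3).toAdelic (weylLongU ((IsCMField.complexConj L : L ≃ₐ[↥(maximalRealSubfield L)] L) : L →+* L) (rfl : (StdForm.antidiagonal 3).over L = (StdForm.antidiagonal 3).over L))) * (v : (quasiSplit (↥(maximalRealSubfield L)) L (IsCMField.complexConj L) 3).Adelic))) : ℝ) : ℂ) ^ ((σ : ℝ) : ℂ) ∂ν)) = borelConstantTerm ν 𝓕 (eisensteinSeriesU (flatSectionU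 (fun _ : (quasiSplit (↥(maximalRealSubfield L)) L (IsCMField.complexConj L) 3).Adelic => (1 : ℂ)) ((σ : ℝ) : ℂ))) 1 - 1 := by
    rw [borelConstantTerm_sphericalEisenstein_cm_three_one L ν h𝓕N h𝓕c 1 hz]; ring
  rw [hc]
  calc (σ - 2) * ‖borelConstantTerm ν 𝓕 (eisensteinSeriesU (flatSectionU (fun _ : (quasiSplit (↥(maximalRealSubfield L)) L (IsCMField.complexConj L) 3).Adelic => (1 : ℂ)) ((σ : ℝ) : ℂ))) 1 - 1‖
      ≤ (σ - 2) * (‖borelConstantTerm ν 𝓕 (eisensteinSeriesU (flatSectionU (fun _ : (quasiSplit (↥(maximalRealSubfield L)) L (IsCMField.complexConj L) 3).Adelic => (1 : ℂ)) ((σ : ℝ) : ℂ))) 1‖ + ‖(1 : ℂ)‖) :=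
        mul_le_mul_of_nonneg_left (norm_sub_le _ _) hσ2.le
    _ = (σ - 2) * ‖borelConstantTerm ν 𝓕 (eisensteinSeriesU (flatSectionU (fun _ : (quasiSplit (↥(maximalRealSubfield L)) L (IsCMField.complexConj L) 3).Adelic => (1 : ℂ)) ((σ : ℝ) : ℂ))) 1‖ + (σ - 2) := by rw [norm_one]; ring
    _ ≤ M + η := add_le_add (by rw [← le_div_iff₀' hσ2]; exact hEB) (by linarith)

/-! ## §4 The head: the `(σ, g)`-uniform majorant of `(σ − 2)·E(φ₀H^σ)(g)` near the pole, from the pole letter -/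

/-- **THE `(σ, g)`-UNIFORM MAJORANT OF `(σ − 2)·E(φ₀H^σ)(g)` NEAR THE POLE `σ = 2ρ_H = 2` OF `U(2,1)_{L∕L⁺}`, HYPOTHESIS-FIRST ON THE POLE LETTER** (road (ρ2)₃ «G7 PROPER», file (R-b)₃,
the `N = 3` twin of ★ `residue_uniform_majorant_cm_two`).  For the CM pair `(L⁺, L)`, a Haar measure `ν` of `N(𝔸_{L⁺})`, a fundamental domain `𝓕` of `N(L⁺)` with compact closure, the
letter `hpole` (local uniform boundedness of `(σ − 2)·E(H^σ)` on compacta for `σ ∈ (2, 2 + η]`), `φ₀ : ℂ` and ANY exponent `A > 2`: there are `η > 0` and `C ≥ 0` with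
**`(σ − 2)·‖E(φ₀H^σ)(g)‖ ≤ C·w₁(g)^A`** for every REAL `σ ∈ (2, 2 + η]` and EVERY `g`, `w₁(g) = ⨆_{γ ∈ G(F)} H(γ g)`.  Proof: §3 turns `hpole` on `𝓕̄·1` into `(σ−2)‖c_ν(σ)‖ ≤ M₀ + η₁`;
★ smearing set `exists_siegel_smear_cm_three` (`γ g = u·y₀·c′`, `H(y₀) = r^{[L:ℚ]} ≥ t^{[L:ℚ]}`) + ★ smear `exists_smear_borelHeight` + §2's average + ★ :82 at `y₀` give
`Σ_q H(γ̃_q γg)^σ ≤ A₀^σ·(H(y₀)^σ + ‖c_ν(σ)‖·H(y₀)^{2−σ})`; `H(y₀) ≤ A₀·H(γg) ≤ A₀·w₁(g)`, `w₁ ≥ c₁ > 0` ★; bookkeeping §1.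
[cite: MoeglinWaldspurger1995, II.1.5 and IV.1.9] [cite: Garrett2018, §2.8 and §3.10] [cite: Godement1964, §8] -/
theorem residue_uniform_majorant_cm_three_of_pole
    (ν : Measure ↥(adelicUnipotent (↥(maximalRealSubfield L)) L (IsCMField.complexConj L) 3)) [ν.IsHaarMeasure] {𝓕 : Set ↥(adelicUnipotent (↥(maximalRealSubfield L)) L (IsCMField.complexConj L) 3)} (h𝓕N : IsFundamentalDomain ↥(rationalUnipotent (↥(maximalRealSubfield L)) L (IsCMField.complexConj L) 3) 𝓕 ν) (h𝓕c : IsCompact (closure 𝓕))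
    (hpole : ∀ K : Set (quasiSplit (↥(maximalRealSubfield L)) L (IsCMField.complexConj L) 3).Adelic, IsCompact K → ∃ η : ℝ, 0 < η ∧ ∃ M : ℝ, ∀ σ : ℝ, 2 < σ → σ ≤ 2 + η → ∀ x ∈ K, (σ - 2) * ‖eisensteinSeriesU (flatSectionU (fun _ : (quasiSplit (↥(maximalRealSubfield L)) L (IsCMField.complexConj L) 3).Adelic => (1 : ℂ)) ((σ : ℝ) : ℂ)) (x)‖ ≤ M)
    (φ₀ : ℂ) {A : ℝ} (hA : 2 < A) :
    ∃ η : ℝ, 0 < η ∧ ∃ C : ℝ, 0 ≤ C ∧ ∀ σ : ℝ, 2 < σ → σ ≤ 2 + η → ∀ g : (quasiSplit (↥(maximalRealSubfield L)) L (IsCMField.complexConj L) 3).Adelic,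
      (σ - 2) * ‖eisensteinSeriesU (flatSectionU (fun _ : (quasiSplit (↥(maximalRealSubfield L)) L (IsCMField.complexConj L) 3).Adelic => φ₀) ((σ : ℝ) : ℂ)) (g)‖ ≤ C * (((⨆ γ : (quasiSplit (↥(maximalRealSubfield L)) L (IsCMField.complexConj L) 3).arithmeticSubgroup, borelHeight ((γ : (quasiSplit (↥(maximalRealSubfield L)) L (IsCMField.complexConj L) 3).Adelic) * g)) : ℝ≥0) : ℝ) ^ A := by
  -- the pole letter on the compact fibre `𝓕̄ · 1`
  obtain ⟨η₁, hη₁, M₀, hM₀⟩ := hpole ((fun u : ↥(adelicUnipotent (↥(maximalRealSubfield L)) L (IsCMField.complexConj L) 3) => (u : (quasiSplit (↥(maximalRealSubfield L)) L (IsCMField.complexConj L) 3).Adelic)) '' closure 𝓕) (h𝓕c.image continuous_subtype_val)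
  have hM : ∀ σ : ℝ, 2 < σ → σ ≤ 2 + η₁ → ∀ u ∈ closure 𝓕, (σ - 2) * ‖eisensteinSeriesU (flatSectionU (fun _ : (quasiSplit (↥(maximalRealSubfield L)) L (IsCMField.complexConj L) 3).Adelic => (1 : ℂ)) ((σ : ℝ) : ℂ)) ((u : (quasiSplit (↥(maximalRealSubfield L)) L (IsCMField.complexConj L) 3).Adelic))‖ ≤ M₀ :=
    fun σ h1 h2 u hu => hM₀ σ h1 h2 _ ⟨u, hu, rfl⟩
  -- ★ the smearing set of the Siegel reduction (`W = 𝓕̄`), ★ the smear constant `A₀ ≥ 1`, ★ `w₁ ≥ c₁ > 0`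
  obtain ⟨t, C, ht, hC, hred⟩ := exists_siegel_smear_cm_three L h𝓕c
  obtain ⟨A₀, hA₀, hsmear⟩ := exists_smear_borelHeight (exists_mem_borelAdelic_mul_mem_standardMaximalCompactGL_cm_three L) hC
  obtain ⟨c₁, hc₁, hw₁⟩ := exists_pos_forall_lt_ciSup_borelHeight_mul_cm_three L
  obtain ⟨u₀, hu₀⟩ : 𝓕.Nonempty := nonempty_of_measure_ne_zero (measure_ne_zero_of_isFundamentalDomain_rationalUnipotent ν h𝓕N)
  -- constants: the height floor `h₀ = t^{[L:ℚ]}` (`H(1) = 1`), the window `η`, the constant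
  obtain ⟨h₀, hh₀def⟩ : ∃ h₀ : ℝ, h₀ = t ^ Module.finrank ℚ L := ⟨_, rfl⟩
  have hh₀ : 0 < h₀ := by rw [hh₀def]; exact pow_pos ht _
  obtain ⟨η, hηdef⟩ : ∃ η : ℝ, η = min η₁ (A - 2) := ⟨_, rfl⟩
  have hη : 0 < η := by rw [hηdef]; exact lt_min hη₁ (sub_pos.2 hA)
  have hηη₁ : η ≤ η₁ := by rw [hηdef]; exact min_le_left _ _
  have hηA : 2 + η ≤ A := by have h := min_le_right η₁ (A - 2); rw [← hηdef] at h; linarith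
  have hA₀' : (1 : ℝ) ≤ (A₀ : ℝ) := by exact_mod_cast hA₀
  have hc₁' : (0 : ℝ) < (c₁ : ℝ) := by exact_mod_cast hc₁
  have hM0' : 0 ≤ M₀ + η₁ := by
    have h := hM (2 + η₁) (by linarith) le_rfl u₀ (subset_closure hu₀)
    nlinarith [norm_nonneg (eisensteinSeriesU (flatSectionU (fun _ : (quasiSplit (↥(maximalRealSubfield L)) L (IsCMField.complexConj L) 3).Adelic => (1 : ℂ)) (((2 + η₁) : ℝ) : ℂ)) ((u₀ : (quasiSplit (↥(maximalRealSubfield L)) L (IsCMField.complexConj L) 3).Adelic))), h, hη₁]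
  have hK0 : 0 ≤ (A₀ : ℝ) ^ A * (η * (1 + ((A₀ : ℝ) * (c₁ : ℝ))⁻¹ ^ A) * (A₀ : ℝ) ^ A + (M₀ + η₁) * (1 + h₀⁻¹ ^ η) * (c₁ : ℝ)⁻¹ ^ A) := by positivity
  refine ⟨η, hη, ‖φ₀‖ * ((A₀ : ℝ) ^ A * (η * (1 + ((A₀ : ℝ) * (c₁ : ℝ))⁻¹ ^ A) * (A₀ : ℝ) ^ A + (M₀ + η₁) * (1 + h₀⁻¹ ^ η) * (c₁ : ℝ)⁻¹ ^ A)),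
    mul_nonneg (norm_nonneg _) hK0, fun σ hσ hση g => ?_⟩
  have hz : (2 : ℝ) < (((σ : ℝ) : ℂ)).re := by rwa [Complex.ofReal_re]
  -- reduce `g`: `γ g = u · y₀ · c′` for every `u ∈ 𝓕̄`, `H(y₀) = r^{[L:ℚ]}`, `r ≥ t`
  obtain ⟨γ, y₀, r, htr, hHy₀, hfac⟩ := hred g
  obtain ⟨γ', hγ'⟩ := MonoidHom.mem_range.1 γ.2
  -- automorphy: `E(φ₀H^σ)(g) = E(φ₀H^σ)(γ g)`
  have haut : eisensteinSeriesU (flatSectionU (fun _ : (quasiSplit (↥(maximalRealSubfield L)) L (IsCMField.complexConj L) 3).Adelic => φ₀) ((σ : ℝ) : ℂ)) (g) = eisensteinSeriesU (flatSectionU (fun _ : (quasiSplit (↥(maximalRealSubfield L)) L (IsCMField.complexConj L) 3).Adelic => φ₀) ((σ : ℝ) : ℂ)) ((γ : (quasiSplit (↥(maximalRealSubfield L)) L (IsCMField.complexConj L) 3).Adelic) * g) := by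
    rw [← hγ']
    exact (eisensteinSeriesU_flatSectionU_rational_mul (φ := fun _ : (quasiSplit (↥(maximalRealSubfield L)) L (IsCMField.complexConj L) 3).Adelic => φ₀) (fun _ _ _ => rfl) ((σ : ℝ) : ℂ) γ' g).symm
  -- the smear: `H(x·γg) ≤ A₀·H(x·u y₀)` for every `u ∈ 𝓕 ⊆ 𝓕̄` and every `x`
  have hsm : ∀ u ∈ 𝓕, ∀ x : (quasiSplit (↥(maximalRealSubfield L)) L (IsCMField.complexConj L) 3).Adelic, borelHeight (x * ((γ : (quasiSplit (↥(maximalRealSubfield L)) L (IsCMField.complexConj L) 3).Adelic) * g)) ≤ A₀ * borelHeight (x * ((u : (quasiSplit (↥(maximalRealSubfield L)) L (IsCMField.complexConj L) 3).Adelic) * y₀)) := by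
    intro u hu x
    obtain ⟨c', hc', hfac'⟩ := hfac u (subset_closure hu)
    rw [hfac', ← mul_assoc x]
    exact (hsmear _ c' hc').1
  -- the constant term of `E(H^σ)` at `y₀` (★ :82, `φ₀ = 1`)
  obtain ⟨cν, hcν⟩ : ∃ cν : ℂ, cν = (((((ν 𝓕).toReal⁻¹ : ℝ)) : ℂ) * (∫ v : ↥(adelicUnipotent (↥(maximalRealSubfield L)) L (IsCMField.complexConj L) 3), (((borelHeight (((quasiSplit (↥(maximalRealSubfield L)) L (IsCMField.complexConj L) 3).toAdelic (weylLongU ((IsCMField.complexConj L : L ≃ₐ[↥(maximalRealSubfield L)] L) : L →+* L) (rfl : (StdForm.antidiagonal 3).over L = (StdForm.antidiagonal 3).over L))) * (v : (quasiSplit (↥(maximalRealSubfield L)) L (IsCMField.complexConj L) 3).Adelic))) : ℝ) : ℂ) ^ ((σ : ℝ) : ℂ) ∂ν)) := ⟨_, rfl⟩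
  have hCT : borelConstantTerm ν 𝓕 (eisensteinSeriesU (flatSectionU (fun _ : (quasiSplit (↥(maximalRealSubfield L)) L (IsCMField.complexConj L) 3).Adelic => (1 : ℂ)) ((σ : ℝ) : ℂ))) y₀ =
      1 * ((((borelHeight y₀ : ℝ)) : ℂ) ^ ((σ : ℝ) : ℂ) + cν * (((borelHeight y₀ : ℝ)) : ℂ) ^ (2 - ((σ : ℝ) : ℂ))) := by
    rw [borelConstantTerm_sphericalEisenstein_cm_three L ν h𝓕N h𝓕c 1 hz y₀, hcν]
  -- §2's average: `Σ_q H(γ̃_q γg)^σ ≤ A₀^σ (H(y₀)^σ + ‖c_ν(σ)‖ H(y₀)^{2−σ})`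
  have hS := tsum_borelHeight_rpow_le_of_borelConstantTerm_three L ν h𝓕N h𝓕c hσ hCT hsm
  -- heights: `h₀ ≤ H(y₀) ≤ A₀·H(γ g) ≤ A₀·w₁(g)`, `c₁ ≤ w₁(g)`
  have hHt : h₀ ≤ (borelHeight y₀ : ℝ) := by
    have h1 : (borelHeight y₀ : ℝ) = ((r : ℝ≥0) : ℝ) ^ Module.finrank ℚ L := by
      rw [hHy₀, borelHeight_one, mul_one, NNReal.coe_pow]
    rw [hh₀def, h1]
    exact pow_le_pow_left₀ ht.le htr _
  have hHw : (borelHeight y₀ : ℝ) ≤ (A₀ : ℝ) * (((⨆ γ : (quasiSplit (↥(maximalRealSubfield L)) L (IsCMField.complexConj L) 3).arithmeticSubgroup, borelHeight ((γ : (quasiSplit (↥(maximalRealSubfield L)) L (IsCMField.complexConj L) 3).Adelic) * g)) : ℝ≥0) : ℝ) := by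
    obtain ⟨c', hc', hfac'⟩ := hfac u₀ (subset_closure hu₀)
    have h1 : borelHeight y₀ = borelHeight ((u₀ : (quasiSplit (↥(maximalRealSubfield L)) L (IsCMField.complexConj L) 3).Adelic) * y₀) := (borelHeight_unipotent_mul u₀.2 y₀).symm
    have h2 : borelHeight ((u₀ : (quasiSplit (↥(maximalRealSubfield L)) L (IsCMField.complexConj L) 3).Adelic) * y₀) ≤ A₀ * borelHeight ((u₀ : (quasiSplit (↥(maximalRealSubfield L)) L (IsCMField.complexConj L) 3).Adelic) * y₀ * c') := (hsmear _ c' hc').2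
    have h3 : borelHeight ((u₀ : (quasiSplit (↥(maximalRealSubfield L)) L (IsCMField.complexConj L) 3).Adelic) * y₀ * c') ≤ (⨆ γ : (quasiSplit (↥(maximalRealSubfield L)) L (IsCMField.complexConj L) 3).arithmeticSubgroup, borelHeight ((γ : (quasiSplit (↥(maximalRealSubfield L)) L (IsCMField.complexConj L) 3).Adelic) * g)) := by
      rw [← hfac']
      exact borelHeight_mul_le_ciSup γ g
    exact_mod_cast (h1.le.trans h2).trans (mul_le_mul_of_nonneg_left h3 (by positivity))
  have hw : (c₁ : ℝ) ≤ (((⨆ γ : (quasiSplit (↥(maximalRealSubfield L)) L (IsCMField.complexConj L) 3).arithmeticSubgroup, borelHeight ((γ : (quasiSplit (↥(maximalRealSubfield L)) L (IsCMField.complexConj L) 3).Adelic) * g)) : ℝ≥0) : ℝ) := by exact_mod_cast (hw₁ g).le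
  -- §3: the pole letter bounds `(σ − 2)·‖c_ν(σ)‖`
  have hMσ : (σ - 2) * ‖cν‖ ≤ M₀ + η₁ := by
    rw [hcν]
    exact sub_two_mul_norm_le_of_pole L ν h𝓕N h𝓕c hM hσ (hση.trans (by linarith))
  -- bookkeeping
  have key := residue_majorant_arith_three hσ hση hηA hA₀' hh₀ hHt hHw hc₁' hw (norm_nonneg cν) hMσ hS
  rw [haut, norm_eisensteinSeriesU_flatSectionU_const_ofReal_three, mul_left_comm, mul_assoc ‖φ₀‖]
  exact mul_le_mul_of_nonneg_left key (norm_nonneg _)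

/-- **THE MAJORANT, HEIGHT FORM** (all `g`): `(σ − 2)·‖E(φ₀H^σ)(g)‖ ≤ C·max(H(g), H(g)⁻¹)^A` — `w₁(g) ≤ max(H(g), H(g)⁻¹)` by the Siegel property ★ `borelHeight_toAdelic_mul_le_max_three`.
[cite: MoeglinWaldspurger1995, I.2.2 and II.1.5] [cite: Garrett2018, §2.3] -/
theorem residue_uniform_majorant_cm_three_of_pole_le_max
    (ν : Measure ↥(adelicUnipotent (↥(maximalRealSubfield L)) L (IsCMField.complexConj L) 3)) [ν.IsHaarMeasure] {𝓕 : Set ↥(adelicUnipotent (↥(maximalRealSubfield L)) L (IsCMField.complexConj L) 3)} (h𝓕N : IsFundamentalDomain ↥(rationalUnipotent (↥(maximalRealSubfield L)) L (IsCMField.complexConj L) 3) 𝓕 ν) (h𝓕c : IsCompact (closure 𝓕))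
    (hpole : ∀ K : Set (quasiSplit (↥(maximalRealSubfield L)) L (IsCMField.complexConj L) 3).Adelic, IsCompact K → ∃ η : ℝ, 0 < η ∧ ∃ M : ℝ, ∀ σ : ℝ, 2 < σ → σ ≤ 2 + η → ∀ x ∈ K, (σ - 2) * ‖eisensteinSeriesU (flatSectionU (fun _ : (quasiSplit (↥(maximalRealSubfield L)) L (IsCMField.complexConj L) 3).Adelic => (1 : ℂ)) ((σ : ℝ) : ℂ)) (x)‖ ≤ M)
    (φ₀ : ℂ) {A : ℝ} (hA : 2 < A) :
    ∃ η : ℝ, 0 < η ∧ ∃ C : ℝ, 0 ≤ C ∧ ∀ σ : ℝ, 2 < σ → σ ≤ 2 + η → ∀ g : (quasiSplit (↥(maximalRealSubfield L)) L (IsCMField.complexConj L) 3).Adelic,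
      (σ - 2) * ‖eisensteinSeriesU (flatSectionU (fun _ : (quasiSplit (↥(maximalRealSubfield L)) L (IsCMField.complexConj L) 3).Adelic => φ₀) ((σ : ℝ) : ℂ)) (g)‖ ≤ C * (max (borelHeight g : ℝ) (borelHeight g : ℝ)⁻¹) ^ A := by
  obtain ⟨η, hη, C, hC, h⟩ := residue_uniform_majorant_cm_three_of_pole L ν h𝓕N h𝓕c hpole φ₀ hA
  refine ⟨η, hη, C, hC, fun σ hσ hση g => (h σ hσ hση g).trans (mul_le_mul_of_nonneg_left ?_ hC)⟩
  have hw : (⨆ γ : (quasiSplit (↥(maximalRealSubfield L)) L (IsCMField.complexConj L) 3).arithmeticSubgroup, borelHeight ((γ : (quasiSplit (↥(maximalRealSubfield L)) L (IsCMField.complexConj L) 3).Adelic) * g)) ≤ max (borelHeight g) (borelHeight g)⁻¹ := by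
    refine ciSup_le fun γ => ?_
    obtain ⟨γ', hγ'⟩ := MonoidHom.mem_range.1 γ.2
    rw [← hγ']
    exact borelHeight_toAdelic_mul_le_max_three γ' g
  have hw' : (((⨆ γ : (quasiSplit (↥(maximalRealSubfield L)) L (IsCMField.complexConj L) 3).arithmeticSubgroup, borelHeight ((γ : (quasiSplit (↥(maximalRealSubfield L)) L (IsCMField.complexConj L) 3).Adelic) * g)) : ℝ≥0) : ℝ) ≤ max (borelHeight g : ℝ) (borelHeight g : ℝ)⁻¹ := by exact_mod_cast hw
  exact Real.rpow_le_rpow (NNReal.coe_nonneg _) hw' (by linarith)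

/-- **THE MAJORANT ON THE SIEGEL SET `{1 ≤ H}`** (the form of the deal): `(σ − 2)·‖E(φ₀H^σ)(g)‖ ≤ C·H(g)^A` for `σ ∈ (2, 2 + η]`, `H(g) ≥ 1`.
[cite: MoeglinWaldspurger1995, I.2.2 and II.1.5] [cite: Garrett2018, §2.8] -/
theorem residue_uniform_majorant_cm_three_of_pole_siegel
    (ν : Measure ↥(adelicUnipotent (↥(maximalRealSubfield L)) L (IsCMField.complexConj L) 3)) [ν.IsHaarMeasure] {𝓕 : Set ↥(adelicUnipotent (↥(maximalRealSubfield L)) L (IsCMField.complexConj L) 3)} (h𝓕N : IsFundamentalDomain ↥(rationalUnipotent (↥(maximalRealSubfield L)) L (IsCMField.complexConj L) 3) 𝓕 ν) (h𝓕c : IsCompact (closure 𝓕))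
    (hpole : ∀ K : Set (quasiSplit (↥(maximalRealSubfield L)) L (IsCMField.complexConj L) 3).Adelic, IsCompact K → ∃ η : ℝ, 0 < η ∧ ∃ M : ℝ, ∀ σ : ℝ, 2 < σ → σ ≤ 2 + η → ∀ x ∈ K, (σ - 2) * ‖eisensteinSeriesU (flatSectionU (fun _ : (quasiSplit (↥(maximalRealSubfield L)) L (IsCMField.complexConj L) 3).Adelic => (1 : ℂ)) ((σ : ℝ) : ℂ)) (x)‖ ≤ M)
    (φ₀ : ℂ) {A : ℝ} (hA : 2 < A) :
    ∃ η : ℝ, 0 < η ∧ ∃ C : ℝ, 0 ≤ C ∧ ∀ σ : ℝ, 2 < σ → σ ≤ 2 + η → ∀ g : (quasiSplit (↥(maximalRealSubfield L)) L (IsCMField.complexConj L) 3).Adelic, 1 ≤ borelHeight g →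
      (σ - 2) * ‖eisensteinSeriesU (flatSectionU (fun _ : (quasiSplit (↥(maximalRealSubfield L)) L (IsCMField.complexConj L) 3).Adelic => φ₀) ((σ : ℝ) : ℂ)) (g)‖ ≤ C * (borelHeight g : ℝ) ^ A := by
  obtain ⟨η, hη, C, hC, h⟩ := residue_uniform_majorant_cm_three_of_pole_le_max L ν h𝓕N h𝓕c hpole φ₀ hA
  refine ⟨η, hη, C, hC, fun σ hσ hση g hg => ?_⟩
  have hg' : (1 : ℝ) ≤ (borelHeight g : ℝ) := by exact_mod_cast hg
  have hmax : max (borelHeight g : ℝ) (borelHeight g : ℝ)⁻¹ = (borelHeight g : ℝ) := max_eq_left ((inv_le_one_of_one_le₀ hg').trans hg')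
  have h' := h σ hσ hση g
  rwa [hmax] at h'

end Summit.HodgeConjecture.HodgeConjecture.Cruxes.H413.K2E1ResidueUniformMajorantCMThree

end
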